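import Summits.CriticalPhenomena.CardyFormulaZ2.Theses.CardyMagicRigidity
import Literature.Topology.PlaneTopology.ArgumentIncrement
import Literature.Probability.Percolation.HexLatticeSegments
import Literature.Probability.Percolation.InterfaceLoopPolygon
import Literature.Probability.Percolation.SiteInterfaceWinding

/-!
# Disproof of `MagicFormulaT` — standing-adversary work file (crux stmt-CriticalPhenomena-4836)

Route `CardyMagicRigidity`, crux rank 4: the site-𝕋 twisted nesting transform
`Λ^𝕋_δ(f) = E_{1/2}[∏_{interface loops u of δ𝕋} 2cos(∫_{wind(u,·)≠0} f + π/3)]` tends, as `δ → 0⁺`,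
to `exp((3/4π²) ∬ log‖x−y‖ f(x) f(y))` for every bounded measurable compactly supported `f` with
`∫ f = 0`.

## Findings (index; details in the docstrings below and in NOTES.md of the refuter folder)

* **F1 (fidelity, no kill).** The Lean rendering matches DKLM arXiv:2603.06268 Cor 10 at `q = 1`
  symbol by symbol with `ℤ²` replaced by `𝕋`: `μ = arccos(√q/2)/2π = 1/6`, `cos_μ(x) =
  cos(x+2πμ)/cos(2πμ) = 2cos(x+π/3)`; `σ² = 2/arccos(−√q/2) = 3/π`; `G_{ℝ²}(x,y) = −(1/2π)log|y−x|`
  (p. 10); `exp(−½σ²∬G f f) = exp(+(3/(4π²))∬ log‖x−y‖ f f)`; test functions = compactly supported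
  finite signed measures of total mass 0 (Def. 5) with finite Dirichlet energy — `f dx` with
  `f ∈ L∞_c`, `∫ f = 0` is such; `int(ℓ)` = bounded complementary component = `{wind ≠ 0}` for the
  simple lattice polygons. See `magicFormulaT_iff`.
* **F2 (no junk at the trivial function).** For `f = 0` every factor is `2cos(π/3) = 1`, the
  `finprod` is `1`, the integrand is integrable, `Λ_δ(0) = 1 = exp 0`: `tNesting_zero`,
  `tGaussian_zero`, `magicFormulaT_conclusion_zero`. The hypotheses are satisfiable
  (`magicFormulaT_hyps_zero`), so the crux is not vacuous.
* **F3 (the finprod is a genuine finite product, δ > 0).** Informal (not yet formalised here): a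
  loop `u` with `∫_{int u} f ∉ {0}` must meet the closed ball `B_R ⊇ supp f` (else `B_R` lies in one
  complementary component, so `∫_{int u} f ∈ {0, ∫ f} = {0}`); distinct interface loops use disjoint
  honeycomb edges; finitely many edges meet `B_R` at mesh `δ > 0`. Hence `mulSupport` is finite for
  EVERY configuration and `|∏| ≤ 2^{N_δ(R)}` with `N_δ(R) = O((R/δ)²)` deterministic: the Bochner
  integral is a genuine expectation once measurability is settled (a.e. limit of cylinder functions).
* **F4 (why it resists — no Lean refutation is possible short of disproving universality).**
  Given `MagicFormulaZ2` (= Cor 10, a theorem modulo the unreleased companion [magicformula]) and the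
  "restrict to big loops" transfer (route item TransferContinuity), `MagicFormulaT ↔` the full-plane
  loop ensembles of bond-ℤ² and site-𝕋 have the same twisted nesting statistics in the limit, which
  follows from loop universality `X`. A refutation of the crux therefore refutes `X` or Cor 10.
* **F5 (sharp necessary condition: evenness).** DKLM p. 10: in the full plane `h` and `−h` have the
  same law, so by the BKW identity (3.2) `Λ^{ℤ²}_δ(f) = Λ^{ℤ²}_δ(−f)` at EVERY mesh. On `𝕋` there is no
  height symmetry; `MagicFormulaT` forces `lim Λ^𝕋_δ(f) = lim Λ^𝕋_δ(−f)` (RHS even in `f`):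
  `magicFormulaT_even_limit`. For antisymmetric `f` (`f ∘ σ = −f`, `σ` a lattice symmetry) this is
  trivial; for e.g. three collinear discs with charges `(1,1,−2)` it is a genuine prediction on the
  3-loop connected nesting statistics of full-plane CLE₆ (first order vanishes by translation
  invariance + neutrality; third order does not vanish termwise).
* **F6 (large charges are consistent).** `2cos(θ+π/3)` is `2π`-periodic in `θ` while the Gaussian
  exponent grows like `λ²`: for `f = 2π(φ_A − φ_B)` macroscopic loops are invisible and the Gaussian
  predicts `Λ → C (ε/r)^6`; consistent because on the six-vertex side `E[e^{2πi(h_A − h(z₀))}] → 0`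
  (equidistribution of the disc average mod 1), i.e. the charge-`2π` insertion has dimension
  `3λ²/4π² = 3`. No contradiction from periodicity.
* **F7 (the route's "cheapest falsifier" is not viable as specified).** A full-plane Monte-Carlo
  estimate of `Λ(f)` in a box of size `L` has a truncation error of order `P(a loop of diameter ≥ L
  cuts supp f) ≍ (ρ/L)^{1/4}` (polychromatic 2-arm exponent) times an `O(λ²)` conditional effect:
  `1%` accuracy needs `L/ρ ~ 10⁸`. What IS testable: (i) `ℤ²` vs `𝕋` in the SAME box with the same
  boundary condition (universality of the box functional, no truncation), (ii) the odd part
  `E[X(f) − X(−f)]/2`, whose truncation error is `O(λ³)`-suppressed. Implemented (refuter folder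
  `mc/nesting.py`: loops ↔ finite clusters of both colours, `int(u_K) = fill(K)`, nesting chains via
  "parent = opposite-colour cluster of the cell below the lowest cell of K"; cross-checked against a
  topological fill). Kit jobs (evidence on this item when they end): `j013443` (validation, T+Z2,
  L=160), `j013709` (T, L=320/640, 6·10⁵ samples, 4 configurations, λ ∈ {1/4,…,2π}), `j013715` (Z2,
  same); queued on a saturated pool at the end of cycle 1 — numbers to be folded in at re-arm.

* **F8 (natural strengthening refuted: the formula is NOT an exact lattice identity).**
  `not_magicFormulaTEveryMesh`: "Λ^𝕋_δ(f) = Gaussian(f) at EVERY mesh δ > 0" is false. Witness: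
  δ = 20, `f = 1_{B(4,1/2)} − 1_{B(−4,1/2)}` (admissible: measurable, |f| ≤ 1, supported in
  ‖z‖ ≤ 5, neutral). Every interface trace at mesh δ stays at distance ≥ δ/2 from every mesh point
  (`half_mesh_le_dist_of_mem_polyTrace`, hex-form arithmetic), so the winding number of every
  loop is constant on B(0,10) ⊇ supp f (`wind_eq_wind_zero_of_mem_tLoops`), every loop weight is
  `2cos(π/3) = 1` (`loopWeight_ftest`), and `Λ_20(f) = 1` (`tNesting_ftest`); but the logarithmic
  energy is negative (`CellTest.Q_neg`, with local integrability of `log‖·‖` in ℂ by polar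
  coordinates, `LogInt.integrableOn_log_norm_ball_zero`), so `Gaussian(f) < 1`
  (`tGaussian_ftest_lt_one`). Moral for provers: all content is in the limit δ → 0; at fixed mesh
  the functional does not see sub-cell structure of `f` while the Gaussian does (the identity
  that IS exact on ℤ² at fixed mesh is BKW eq. (3.2) with the six-vertex height function, not the
  Gaussian).

* **F9 (why it resists, formally).** `magicFormulaT_of_loopLimit`: `LoopLimitZ2EqT → MagicFormulaZ2 →
  TransferContinuity → MagicFormulaT` (three lines: `Tendsto.sub` + `sub_sub_cancel`). So the crux
  is a CONSEQUENCE of the target plus the ℤ² input fact plus the routine transfer; refuting it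
  refutes that conjunction, i.e. (granting Cor 10 and the transfer) loop universality itself.

* **F10 (barrier reduction: what any proof must use).** Beffara's push-forward
  (`Literature.Barriers.CriticalPhenomena.EmbeddingModulusUniqueness`): interface loops and their
  interiors are combinatorial, so for the sheared lattice `φ_β(𝕋)` the transform equals
  `Λ^𝕋_δ` of the pulled-back density `|det φ_β| · f ∘ φ_β`; if the crux holds, the sheared lattice's
  limit is the Gaussian of the SHEARED kernel `log‖φ_β⁻¹x − φ_β⁻¹y‖`, not of `log‖x−y‖`. Hence an
  argument that never uses the equilateral embedding (`triEmbed`/`hexCenter`, entering the crux only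
  through `siteLoopCurve`) — RSW, combinatorial exploration, any mesh-rescaling technique — would
  prove the isotropic Gaussian for `φ_β(𝕋)` as well, a contradiction: the load-bearing input of any
  proof is an exactly-solvable / discrete-holomorphic fact tied to the isotropic embedding (on `ℤ²`:
  Bethe ansatz at `a = b = 1`, `c = √3` plus DKKMO rotation invariance; on `𝕋`: Smirnov's theorem ⇒
  Camia–Newman CLE₆, i.e. the route through universality of F4/F9). No barrier makes the STATEMENT
  suspicious; they constrain proofs only.

## Landing status
The gate accepts from a refuter under `Theorems/` only `¬ <Theses decl>` (bounce code
`theorems.refuter`; flat `Theorems/<Name>.lean` only, no `Theorems/<Crux>/Negative/` directory), so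
F8/F9 travel as item evidence (this file) and via the harness-published copy of this file at
`Summits/CriticalPhenomena/CardyFormulaZ2/Cruxes/MagicFormulaT/Disproof.lean`; split landing files
(`MagicFormulaTHexEdgeDistance`, `MagicFormulaTLogEnergy`, `MagicFormulaTNotEveryMesh`, each < 400
lines, lean-checked) are kept in the refuter folder for a prover to land with `--supports`.

## Targets
None handed over (payload.targets = []).
-/

noncomputable section

open MeasureTheory Filter Set Metric Complex
open scoped Topology Real ENNReal unitInterval

namespace Summit.CriticalPhenomena.CardyFormulaZ2.Cruxes.MagicFormulaT.Disproof

open Literature.Probability.RandomPlanarGeometry Literature.Probability.Percolation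
  Literature.Probability.LatticeModels Literature.Topology.PlaneTopology

/-- The set of interface loops of the site configuration `cfg` at mesh `δ`, as unbased oriented
loops (exactly the index set of the crux's `finprod`). [folklore] -/
def tLoops (δ : ℝ) (cfg : SiteConfig (Site 2)) : Set (UnbasedLoop ℂ) :=
  {u : UnbasedLoop ℂ | ∃ (v : HexVertex) (γ : hexGraph.Walk v v), IsSiteInterfaceLoop cfg γ ∧
    u = UnbasedLoop.mk (BasedLoop.mk (siteLoopCurve δ γ) (isLoop_siteLoopCurve δ γ))}

/-- The twisted nesting weight of one loop: `cos_μ(∫_{int u} f) = 2cos(∫_{wind ≠ 0} f + π/3)`,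
`μ = 1/6` (DKLM arXiv:2603.06268 eq. (3.2) at `q = 1`). [cite: DuminilCopinKozlowskiLammersManolescu2026, eq. (3.2)] -/
def loopWeight (f : ℂ → ℝ) (u : UnbasedLoop ℂ) : ℝ :=
  2 * Real.cos ((∫ z in {z : ℂ | u.wind z ≠ 0}, f z) + Real.pi / 3)

/-- The site-𝕋 twisted nesting transform `Λ^𝕋_δ(f)` of the crux. [folklore] -/
def tNesting (f : ℂ → ℝ) (δ : ℝ) : ℝ :=
  ∫ cfg, (∏ᶠ u ∈ tLoops δ cfg, loopWeight f u) ∂(triSitePercolation half)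

/-- The claimed Gaussian limit `exp((3/4π²) ∬ log‖x−y‖ f(x) f(y))` (`= exp(−½σ²∬G_{ℝ²} f f)`,
`σ² = 3/π`, `G = −(1/2π) log`). [cite: DuminilCopinKozlowskiLammersManolescu2026, Cor. 10] -/
def tGaussian (f : ℂ → ℝ) : ℝ :=
  Real.exp (3 / (4 * Real.pi ^ 2) * ∫ x, ∫ y, Real.log ‖x - y‖ * f x * f y)

/-- **F1.** The crux, unfolded: it is literally the statement that `Λ^𝕋_δ(f) → tGaussian f` for every
admissible `f` (definitional). [folklore] -/
theorem magicFormulaT_iff :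
    Theses.CardyMagicRigidity.MagicFormulaT ↔
      ∀ (f : ℂ → ℝ) (R C : ℝ), Measurable f → (∀ z, |f z| ≤ C) → (∀ z, R < ‖z‖ → f z = 0) →
        ∫ z, f z = 0 → Tendsto (tNesting f) (𝓝[>] 0) (𝓝 (tGaussian f)) :=
  Iff.rfl

/-- **F2.** Every loop weight of the zero test function is `2cos(π/3) = 1`. [folklore] -/
theorem loopWeight_zero (u : UnbasedLoop ℂ) : loopWeight (fun _ ↦ 0) u = 1 := by
  simp [loopWeight, Real.cos_pi_div_three]

/-- **F2.** `Λ^𝕋_δ(0) = 1` at every mesh (the `finprod` of ones is `1`, and `triSitePercolation` is a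
probability measure). [folklore] -/
theorem tNesting_zero (δ : ℝ) : tNesting (fun _ ↦ 0) δ = 1 := by
  simp [tNesting, loopWeight_zero]

/-- **F2.** The Gaussian functional of the zero test function is `1`. [folklore] -/
theorem tGaussian_zero : tGaussian (fun _ ↦ 0) = 1 := by
  simp [tGaussian]

/-- **F2.** The hypotheses of the crux are satisfiable (by `f = 0`, `R = 0`, `C = 0`): the crux is not
vacuous. [folklore] -/
theorem magicFormulaT_hyps_zero :
    Measurable (fun _ : ℂ ↦ (0 : ℝ)) ∧ (∀ z : ℂ, |(fun _ : ℂ ↦ (0 : ℝ)) z| ≤ 0) ∧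
      (∀ z : ℂ, (0 : ℝ) < ‖z‖ → (fun _ : ℂ ↦ (0 : ℝ)) z = 0) ∧ ∫ z : ℂ, (fun _ : ℂ ↦ (0 : ℝ)) z = 0 := by
  refine ⟨measurable_const, fun z ↦ by simp, fun z _ ↦ rfl, by simp⟩

/-- **F2.** The conclusion of the crux holds at `f = 0` (no junk: both sides are `1`). [folklore] -/
theorem magicFormulaT_conclusion_zero :
    Tendsto (tNesting (fun _ ↦ 0)) (𝓝[>] 0) (𝓝 (tGaussian fun _ ↦ 0)) := by
  simp only [tGaussian_zero, funext tNesting_zero]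
  exact tendsto_const_nhds

/-- **F5.** The Gaussian functional is even in `f`. [folklore] -/
theorem tGaussian_neg (f : ℂ → ℝ) : tGaussian (fun z ↦ -f z) = tGaussian f := by
  simp only [tGaussian]
  congr 1
  congr 1
  refine integral_congr_ae (ae_of_all _ fun x ↦ ?_)
  refine integral_congr_ae (ae_of_all _ fun y ↦ ?_)
  ring

/-- **F5 (evenness is necessary).** If the crux holds then the limit of the 𝕋-transform is even in
`f`: `Λ^𝕋_δ(−f)` has the same limit as `Λ^𝕋_δ(f)`. On `ℤ²` evenness holds at every mesh (DKLM p. 10 +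
eq. (3.2)); on `𝕋` it is a prediction about CLE₆ 3-loop nesting statistics (third order in `f`).
[folklore] -/
theorem magicFormulaT_even_limit (h : Theses.CardyMagicRigidity.MagicFormulaT)
    (f : ℂ → ℝ) (R C : ℝ) (hf : Measurable f) (hC : ∀ z, |f z| ≤ C) (hR : ∀ z, R < ‖z‖ → f z = 0)
    (h0 : ∫ z, f z = 0) :
    Tendsto (tNesting fun z ↦ -f z) (𝓝[>] 0) (𝓝 (tGaussian f)) := by
  rw [← tGaussian_neg f]
  refine (magicFormulaT_iff.1 h) (fun z ↦ -f z) R C hf.neg (fun z ↦ by simpa using hC z)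
    (fun z hz ↦ by simp [hR z hz]) ?_
  simp [integral_neg, h0]

/-! ### F8, step 1: winding numbers of curves are locally constant off the trace -/

/-- The winding number of a loop is constant on connected sets missing its trace. [folklore] -/
theorem curve_wind_eq_of_mem_connectedComponentIn {γ : Curve ℂ} (hγ : γ.IsLoop) {p q : ℂ}
    (hq : q ∈ connectedComponentIn (γ.range)ᶜ p) : γ.wind p = γ.wind q := by
  have h01 : IccExtend zero_le_one γ 0 = IccExtend zero_le_one γ 1 := by
    rw [IccExtend_of_mem _ _ ⟨le_rfl, zero_le_one⟩, IccExtend_of_mem _ _ ⟨zero_le_one, le_rfl⟩]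
    have := hγ
    rw [Curve.isLoop_iff, Curve.source_def, Curve.target_def] at this
    exact this
  have hmaps : MapsTo (IccExtend zero_le_one γ) (Icc 0 1) γ.range := by
    intro t ht
    rw [IccExtend_of_mem _ _ ht]
    exact ⟨_, rfl⟩
  have hclosed : IsClosed γ.range := γ.isCompact_range.isClosed
  exact wind_sub_eq_of_mem_connectedComponentIn (γ.continuous.Icc_extend').continuousOn h01 hclosed hmaps hq

/-- The winding number of a loop is constant on a preconnected set missing its trace. [folklore] -/
theorem curve_wind_eq_of_isPreconnected {γ : Curve ℂ} (hγ : γ.IsLoop) {S : Set ℂ} (hS : IsPreconnected S)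
    (hdisj : Disjoint S γ.range) {p q : ℂ} (hp : p ∈ S) (hq : q ∈ S) : γ.wind p = γ.wind q :=
  curve_wind_eq_of_mem_connectedComponentIn hγ
    (hS.subset_connectedComponentIn hp (fun _ hx ↦ Set.disjoint_left.1 hdisj hx) hq)


/-! ### F8, step 2: interface traces keep distance `δ/2` from mesh points (hex-form arithmetic) -/

/-- `‖z‖² = X² + XY + Y²` in the triangular coordinates `X = triX z`, `Y = triY z`. [folklore] -/
theorem norm_sq_eq_tri (z : ℂ) : ‖z‖ ^ 2 = triX z ^ 2 + triX z * triY z + triY z ^ 2 := by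
  have h3 : Real.sqrt 3 ^ 2 = 3 := Real.sq_sqrt (by norm_num)
  have hs : Real.sqrt 3 ≠ 0 := Real.sqrt_ne_zero'.2 (by norm_num)
  rw [Complex.sq_norm, Complex.normSq_apply, triX, triY]
  field_simp
  nlinarith [h3]

/-- Each hex form is dominated by twice the norm: `μ_i(z)² ≤ 4‖z‖²`. [folklore] -/
theorem hform_sq_le (i : Fin 3) (z : ℂ) : hform i z ^ 2 ≤ 4 * ‖z‖ ^ 2 := by
  rw [norm_sq_eq_tri]
  fin_cases i <;> simp [hform] <;>
    nlinarith [sq_nonneg (triX z + triY z), sq_nonneg (triX z), sq_nonneg (triY z)]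

/-- The hex forms are additive. [folklore] -/
theorem hform_sub (i : Fin 3) (p q : ℂ) : hform i (p - q) = hform i p - hform i q := by
  fin_cases i <;> simp [hform, triX_sub, triY_sub] <;> ring

/-- The integral values of the hex forms at the site `a`. [folklore] -/
def hsiteZ (i : Fin 3) (a : Site 2) : ℤ := ![a 0 - a 1, a 0 + 2 * a 1, 2 * a 0 + a 1] i

/-- **Sites have integral hex forms.** [folklore] -/
theorem hform_triEmbed (i : Fin 3) (a : Site 2) : hform i (triEmbed a) = ((hsiteZ i a : ℤ) : ℝ) := by
  fin_cases i <;> simp [hform, hsiteZ, triX_triEmbed, triY_triEmbed]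

/-- **Face centres are not sites.** [folklore] -/
theorem hexCenter_ne_triEmbed (G : HexVertex) (a : Site 2) : hexCenter G ≠ triEmbed a := by
  rcases G with ⟨y, s⟩
  intro h
  have hX := congrArg triX h
  rw [triX_hexCenter, triX_triEmbed] at hX
  have key : (3 : ℝ) * ((a 0 : ℤ) - y 0 : ℝ) = (s : ℕ) + 1 := by linarith
  have key' : (3 : ℤ) * (a 0 - y 0) = (s : ℕ) + 1 := by exact_mod_cast key
  have hs := s.isLt
  omega

/-- **Every point of an edge of the hexagonal lattice is at distance `≥ 1/2` from every site**
(unit mesh): the type form of the edge is integral along it; if it differs from its (integral)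
value at the site the bound follows from `hform_sq_le`, and if not, one of the other two forms
runs between two nonzero integers of the same sign along the edge. [folklore] -/
theorem half_le_norm_sub_triEmbed_of_mem_hexEdge {F : HexVertex} {j : Fin 3} {q : ℂ}
    (hq : q ∈ segment ℝ (hexCenter F) (hexCenter (oppFace F j))) (a : Site 2) :
    1 / 2 ≤ ‖q - triEmbed a‖ := by
  rcases F with ⟨x, t⟩
  obtain ⟨θ, h0, h1, hθ0⟩ := exists_param_of_mem_hexEdge hq
  have hθ : ∀ i, hform i q = hform i (hexCenter (x, t)) + θ * hdelta t j i := hθ0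
  -- the forms of `q - a`
  have hD : ∀ i, hform i (q - triEmbed a) = (hformZ i x t : ℝ) - (hsiteZ i a : ℝ) + θ * hdelta t j i := by
    intro i
    rw [hform_sub, hθ i, hform_hexCenter, hform_triEmbed]
    ring
  -- it suffices to find a form of absolute value ≥ 1
  suffices key : ∃ i, 1 ≤ hform i (q - triEmbed a) ^ 2 by
    obtain ⟨i, hi⟩ := key
    have h4 := hform_sq_le i (q - triEmbed a)
    nlinarith [norm_nonneg (q - triEmbed a)]
  set i₀ := htype t j with hi₀
  by_cases hk : hformZ i₀ x t - hsiteZ i₀ a = 0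
  · -- the site lies on the line of the edge: use the next form
    set i₁ : Fin 3 := i₀ + 1 with hi₁
    have hne : i₁ ≠ i₀ := by
      rw [hi₁]; clear_value i₀; fin_cases i₀ <;> decide
    have hε := hdelta_eq_one_or_of_ne (t := t) (j := j) (i := i₁) (by rwa [← hi₀])
    set d₀ : ℤ := hformZ i₁ x t - hsiteZ i₁ a with hd₀
    -- `d₀ ≠ 0`: else the centre of `F` would be the site `a`
    have hk0 : hform i₀ (hexCenter (x, t)) = hform i₀ (triEmbed a) := by
      rw [hform_hexCenter, hform_triEmbed]
      have : (hformZ i₀ x t : ℝ) - (hsiteZ i₀ a : ℝ) = 0 := by exact_mod_cast hk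
      linarith
    have hd₀ne : d₀ ≠ 0 := by
      intro h
      apply hexCenter_ne_triEmbed (x, t) a
      refine eq_of_hform_eq hne ?_ hk0
      rw [hform_hexCenter, hform_triEmbed]
      have : (hformZ i₁ x t : ℝ) - (hsiteZ i₁ a : ℝ) = 0 := by rw [hd₀] at h; exact_mod_cast h
      linarith
    -- `d₀ + ε ≠ 0`: else the centre of the opposite face would be the site `a`
    have hd₁ne : (d₀ : ℝ) + hdelta t j i₁ ≠ 0 := by
      intro h
      apply hexCenter_ne_triEmbed (oppFace (x, t) j) a
      refine eq_of_hform_eq hne ?_ ?_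
      · have e1 : hform i₁ (hexCenter (oppFace (x, t) j)) = hform i₁ (hexCenter (x, t)) + hdelta t j i₁ :=
          hform_hexCenter_oppFace i₁ (x, t) j
        rw [e1, hform_hexCenter, hform_triEmbed]
        have : ((hformZ i₁ x t : ℝ) - (hsiteZ i₁ a : ℝ)) + hdelta t j i₁ = 0 := by
          rw [hd₀] at h; push_cast at h; exact h
        linarith
      · have e0 : hform i₀ (hexCenter (oppFace (x, t) j)) = hform i₀ (hexCenter (x, t)) + hdelta t j i₀ :=
          hform_hexCenter_oppFace i₀ (x, t) j
        rw [e0, hk0, hi₀, hdelta_htype, add_zero]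
    refine ⟨i₁, ?_⟩
    have hDi : hform i₁ (q - triEmbed a) = (d₀ : ℝ) + θ * hdelta t j i₁ := by
      rw [hD, hd₀]; push_cast; ring
    rw [hDi]
    rcases hε with hε | hε <;> rw [hε] at hd₁ne ⊢
    · have hcase : (1 : ℤ) ≤ d₀ ∨ d₀ ≤ -2 := by
        have : d₀ + 1 ≠ 0 := fun h ↦ hd₁ne (by exact_mod_cast h)
        omega
      rcases hcase with h | h
      · have : (1 : ℝ) ≤ d₀ := by exact_mod_cast h
        nlinarith
      · have : (d₀ : ℝ) ≤ -2 := by exact_mod_cast h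
        nlinarith
    · have hcase : (2 : ℤ) ≤ d₀ ∨ d₀ ≤ -1 := by
        have : d₀ - 1 ≠ 0 := fun h ↦ hd₁ne (by exact_mod_cast h)
        omega
      rcases hcase with h | h
      · have : (2 : ℝ) ≤ d₀ := by exact_mod_cast h
        nlinarith
      · have : (d₀ : ℝ) ≤ -1 := by exact_mod_cast h
        nlinarith
  · -- the type form differs by a nonzero integer
    refine ⟨i₀, ?_⟩
    have hDi : hform i₀ (q - triEmbed a) = ((hformZ i₀ x t - hsiteZ i₀ a : ℤ) : ℝ) := by
      rw [hD, hi₀, hdelta_htype]; push_cast; ring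
    rw [hDi]
    have hcase : (1 : ℤ) ≤ hformZ i₀ x t - hsiteZ i₀ a ∨ hformZ i₀ x t - hsiteZ i₀ a ≤ -1 := by omega
    rcases hcase with h | h
    · have : (1 : ℝ) ≤ ((hformZ i₀ x t - hsiteZ i₀ a : ℤ) : ℝ) := by exact_mod_cast h
      nlinarith
    · have : ((hformZ i₀ x t - hsiteZ i₀ a : ℤ) : ℝ) ≤ -1 := by exact_mod_cast h
      nlinarith

/-- **The trace of an interface loop at mesh `δ > 0` stays at distance `≥ δ/2` from every mesh
point.** [folklore] -/
theorem half_mesh_le_dist_of_mem_polyTrace {ω : SiteConfig (Site 2)} {f₀ : HexVertex}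
    {w : hexGraph.Walk f₀ f₀} (hw : IsSiteInterfaceLoop ω w) {δ : ℝ} (hδ : 0 < δ) {q : ℂ}
    (hq : q ∈ polyTrace δ w) (a : Site 2) : δ / 2 ≤ dist q (triMeshPoint δ a) := by
  obtain ⟨i, hi, hqi⟩ := mem_polyTrace_iff.1 hq
  rw [polyPiece, polyPt, polyPt, mem_segment_mul_iff hδ.ne', hw.getVert_succ_eq hi] at hqi
  have key := half_le_norm_sub_triEmbed_of_mem_hexEdge hqi a
  have hsc : q - triMeshPoint δ a = (δ : ℂ) * ((δ⁻¹ : ℝ) • q - triEmbed a) := by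
    rw [triMeshPoint, mul_sub, Complex.real_smul, Complex.ofReal_inv, ← mul_assoc,
      mul_inv_cancel₀ (Complex.ofReal_ne_zero.2 hδ.ne'), one_mul]
  rw [dist_eq_norm, hsc, norm_mul, Complex.norm_real, Real.norm_eq_abs, abs_of_pos hδ]
  nlinarith

/-- **The open ball of radius `δ/2` about a mesh point misses the trace of every interface loop.**
[folklore] -/
theorem ball_disjoint_polyTrace {ω : SiteConfig (Site 2)} {f₀ : HexVertex}
    {w : hexGraph.Walk f₀ f₀} (hw : IsSiteInterfaceLoop ω w) {δ : ℝ} (hδ : 0 < δ) (a : Site 2) :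
    Disjoint (ball (triMeshPoint δ a) (δ / 2)) (polyTrace δ w) := by
  refine disjoint_left.2 fun q hq hq' ↦ ?_
  have := half_mesh_le_dist_of_mem_polyTrace hw hδ hq' a
  rw [mem_ball] at hq
  linarith


/-! ### F8, step 3: local integrability of `log ‖·‖` in `ℂ` and the negative energy of the test density -/

namespace LogInt

/-- `r ↦ r log r` is bounded on `[0, R]`. [folklore] -/
theorem exists_bound_mul_log (R : ℝ) : ∃ M, 0 ≤ M ∧ ∀ r ∈ Icc (0 : ℝ) R, |r * Real.log r| ≤ M := by
  obtain ⟨M, hM⟩ := (isCompact_Icc (a := (0 : ℝ)) (b := R)).exists_bound_of_continuousOn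
    Real.continuous_mul_log.continuousOn
  refine ⟨max M 0, le_max_right _ _, fun r hr ↦ ?_⟩
  have := hM r hr
  rw [Real.norm_eq_abs] at this
  exact this.trans (le_max_left _ _)

/-- **`log ‖·‖` is integrable on every disc about `0` in `ℂ`** (polar coordinates: the radial
density `r log r` is bounded). [folklore] -/
theorem integrableOn_log_norm_ball_zero (R : ℝ) :
    IntegrableOn (fun y : ℂ ↦ Real.log ‖y‖) (ball 0 R) := by
  obtain ⟨M, hM0, hM⟩ := exists_bound_mul_log R
  have hmeas : Measurable fun y : ℂ ↦ Real.log ‖y‖ := Real.measurable_log.comp measurable_norm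
  refine ⟨hmeas.aestronglyMeasurable, ?_⟩
  -- finite integral via polar coordinates
  have hT : volume (Ioo (0 : ℝ) R ×ˢ Ioo (-π) π) < ∞ := by
    rw [Measure.volume_eq_prod, Measure.prod_prod, Real.volume_Ioo, Real.volume_Ioo]
    exact ENNReal.mul_lt_top ENNReal.ofReal_lt_top ENNReal.ofReal_lt_top
  unfold HasFiniteIntegral
  rw [← lintegral_indicator measurableSet_ball, ← Complex.lintegral_comp_polarCoord_symm]
  calc ∫⁻ p in polarCoord.target, ENNReal.ofReal p.1 •
          (ball (0 : ℂ) R).indicator (fun y ↦ ‖Real.log ‖y‖‖ₑ) (Complex.polarCoord.symm p)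
      ≤ ∫⁻ p in polarCoord.target, (Ioo (0 : ℝ) R ×ˢ Ioo (-π) π).indicator (fun _ ↦ ENNReal.ofReal M) p := by
        refine setLIntegral_mono' polarCoord.open_target.measurableSet fun p hp ↦ ?_
        have hp1 : 0 < p.1 := hp.1
        have hnorm : ‖Complex.polarCoord.symm p‖ = p.1 := by
          rw [Complex.norm_polarCoord_symm, abs_of_pos hp1]
        by_cases hR : p.1 < R
        · have hmem : Complex.polarCoord.symm p ∈ ball (0 : ℂ) R := by
            rw [mem_ball_zero_iff, hnorm]; exact hR
          have hmem' : p ∈ Ioo (0 : ℝ) R ×ˢ Ioo (-π) π := ⟨⟨hp1, hR⟩, hp.2⟩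
          rw [indicator_of_mem hmem, indicator_of_mem hmem', hnorm, smul_eq_mul,
            Real.enorm_eq_ofReal_abs, ← ENNReal.ofReal_mul hp1.le]
          refine ENNReal.ofReal_le_ofReal ?_
          have := hM p.1 ⟨hp1.le, hR.le⟩
          rwa [abs_mul, abs_of_pos hp1] at this
        · have hnmem : Complex.polarCoord.symm p ∉ ball (0 : ℂ) R := by
            rw [mem_ball_zero_iff, hnorm]; exact hR
          rw [indicator_of_notMem hnmem, smul_zero]
          exact bot_le
    _ ≤ ∫⁻ p, (Ioo (0 : ℝ) R ×ˢ Ioo (-π) π).indicator (fun _ ↦ ENNReal.ofReal M) p :=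
        setLIntegral_le_lintegral _ _
    _ = ENNReal.ofReal M * volume (Ioo (0 : ℝ) R ×ˢ Ioo (-π) π) :=
        lintegral_indicator_const (measurableSet_Ioo.prod measurableSet_Ioo) _
    _ < ∞ := ENNReal.mul_lt_top ENNReal.ofReal_lt_top hT

/-- `log ‖x - ·‖` is integrable on every disc about `x`. [folklore] -/
theorem integrableOn_log_norm_sub_ball (x : ℂ) (R : ℝ) :
    IntegrableOn (fun y : ℂ ↦ Real.log ‖x - y‖) (ball x R) := by
  have h1 : MeasurePreserving (fun v : ℂ ↦ x + v) volume volume := measurePreserving_add_left volume x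
  have h2 : MeasurableEmbedding (fun v : ℂ ↦ x + v) := (MeasurableEquiv.addLeft x).measurableEmbedding
  have hpre : (fun v : ℂ ↦ x + v) ⁻¹' ball x R = ball 0 R := by
    ext v; simp [dist_eq_norm]
  have key := (h1.integrableOn_comp_preimage h2 (f := fun y : ℂ ↦ Real.log ‖x - y‖) (s := ball x R))
  rw [hpre] at key
  refine key.1 ?_
  have : ((fun y : ℂ ↦ Real.log ‖x - y‖) ∘ fun v : ℂ ↦ x + v) = fun v ↦ Real.log ‖v‖ := by
    ext v; simp
  rw [this]
  exact integrableOn_log_norm_ball_zero R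

/-- Translation of the absolute logarithmic integral over a disc. [folklore] -/
theorem setIntegral_abs_log_norm_sub_ball (x : ℂ) (R : ℝ) :
    ∫ y in ball x R, |Real.log ‖x - y‖| = ∫ v in ball (0 : ℂ) R, |Real.log ‖v‖| := by
  have h1 : MeasurePreserving (fun v : ℂ ↦ x + v) volume volume := measurePreserving_add_left volume x
  have h2 : MeasurableEmbedding (fun v : ℂ ↦ x + v) := (MeasurableEquiv.addLeft x).measurableEmbedding
  have hpre : (fun v : ℂ ↦ x + v) ⁻¹' ball x R = ball 0 R := by
    ext v; simp [dist_eq_norm]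
  have key := h1.setIntegral_preimage_emb h2 (fun y : ℂ ↦ |Real.log ‖x - y‖|) (ball x R)
  rw [hpre] at key
  rw [← key]
  simp

end LogInt

namespace CellTest

open LogInt

/-- The first test disc `B(4, 1/2)`. [folklore] -/
def D₁ : Set ℂ := ball (4 : ℂ) (1 / 2)
/-- The second test disc `B(−4, 1/2)`. [folklore] -/
def D₂ : Set ℂ := ball (-4 : ℂ) (1 / 2)

/-- The test density `1_{D₁} − 1_{D₂}`. [folklore] -/
def ftest : ℂ → ℝ := fun z ↦ D₁.indicator 1 z - D₂.indicator 1 z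

/-- `D₁` is measurable. [folklore] -/
theorem measurableSet_D₁ : MeasurableSet D₁ := measurableSet_ball
/-- `D₂` is measurable. [folklore] -/
theorem measurableSet_D₂ : MeasurableSet D₂ := measurableSet_ball

/-- The test density is measurable. [folklore] -/
theorem measurable_ftest : Measurable ftest :=
  (measurable_const.indicator measurableSet_D₁).sub (measurable_const.indicator measurableSet_D₂)

/-- Two points of a disc of radius `1/2` are at distance `< 1`. [folklore] -/
theorem norm_sub_lt_of_mem {c : ℂ} {x y : ℂ} (hx : x ∈ ball c (1 / 2)) (hy : y ∈ ball c (1 / 2)) :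
    ‖x - y‖ < 1 := by
  rw [mem_ball, dist_eq_norm] at hx hy
  calc ‖x - y‖ = ‖(x - c) - (y - c)‖ := by ring_nf
    _ ≤ ‖x - c‖ + ‖y - c‖ := norm_sub_le _ _
    _ < 1 / 2 + 1 / 2 := add_lt_add hx hy
    _ = 1 := by norm_num

/-- Points of the two test discs are at distance `≥ 7`. [folklore] -/
theorem seven_le_norm_sub {x y : ℂ} (hx : x ∈ D₁) (hy : y ∈ D₂) : 7 ≤ ‖x - y‖ := by
  rw [D₁, mem_ball, dist_eq_norm] at hx
  rw [D₂, mem_ball, dist_eq_norm] at hy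
  have h8 : ‖(4 : ℂ) - (-4)‖ = 8 := by norm_num
  have := norm_sub_le_norm_sub_add_norm_sub (4 : ℂ) x (-4 : ℂ)
  have := norm_sub_le_norm_sub_add_norm_sub x y (-4 : ℂ)
  have hx' : ‖(4 : ℂ) - x‖ < 1 / 2 := by rwa [norm_sub_rev]
  linarith

/-- Points of the two test discs are at distance `≥ 7` (symmetric form). [folklore] -/
theorem seven_le_norm_sub' {x y : ℂ} (hx : x ∈ D₂) (hy : y ∈ D₁) : 7 ≤ ‖x - y‖ := by
  rw [norm_sub_rev]; exact seven_le_norm_sub hy hx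

/-- The test discs are disjoint. [folklore] -/
theorem disjoint_D : Disjoint D₁ D₂ := by
  refine disjoint_left.2 fun x hx hx' ↦ ?_
  have := seven_le_norm_sub hx hx'
  simp at this
  linarith

/-- `D₁ ⊆ B(0,5)`. [folklore] -/
theorem D₁_subset : D₁ ⊆ ball (0 : ℂ) 5 := by
  intro x hx
  rw [D₁, mem_ball, dist_eq_norm] at hx
  rw [mem_ball_zero_iff]
  have := norm_le_norm_add_norm_sub' x (4 : ℂ)
  have h4 : ‖(4 : ℂ)‖ = 4 := by norm_num
  linarith

/-- `D₂ ⊆ B(0,5)`. [folklore] -/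
theorem D₂_subset : D₂ ⊆ ball (0 : ℂ) 5 := by
  intro x hx
  rw [D₂, mem_ball, dist_eq_norm] at hx
  rw [mem_ball_zero_iff]
  have := norm_le_norm_add_norm_sub' x (-4 : ℂ)
  have h4 : ‖(-4 : ℂ)‖ = 4 := by norm_num
  linarith

/-- The test density is `1` on `D₁`. [folklore] -/
theorem ftest_of_mem_D₁ {z : ℂ} (hz : z ∈ D₁) : ftest z = 1 := by
  have hz' : z ∉ D₂ := disjoint_left.1 disjoint_D hz
  simp [ftest, indicator_of_mem hz, indicator_of_notMem hz']

/-- The test density is `−1` on `D₂`. [folklore] -/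
theorem ftest_of_mem_D₂ {z : ℂ} (hz : z ∈ D₂) : ftest z = -1 := by
  have hz' : z ∉ D₁ := disjoint_right.1 disjoint_D hz
  simp [ftest, indicator_of_mem hz, indicator_of_notMem hz']

/-- The test density vanishes off the discs. [folklore] -/
theorem ftest_of_notMem {z : ℂ} (h1 : z ∉ D₁) (h2 : z ∉ D₂) : ftest z = 0 := by
  simp [ftest, indicator_of_notMem h1, indicator_of_notMem h2]

/-- The test density vanishes outside `B(0,5)`. [folklore] -/
theorem ftest_eq_zero_of_norm {z : ℂ} (hz : 5 ≤ ‖z‖) : ftest z = 0 := by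
  refine ftest_of_notMem (fun h ↦ ?_) (fun h ↦ ?_)
  · have := D₁_subset h; rw [mem_ball_zero_iff] at this; linarith
  · have := D₂_subset h; rw [mem_ball_zero_iff] at this; linarith

/-- The test density is bounded by `1`. [folklore] -/
theorem abs_ftest_le (z : ℂ) : |ftest z| ≤ 1 := by
  by_cases h1 : z ∈ D₁
  · rw [ftest_of_mem_D₁ h1]; simp
  by_cases h2 : z ∈ D₂
  · rw [ftest_of_mem_D₂ h2]; simp
  rw [ftest_of_notMem h1 h2]; simp

/-- `1_{D₁}` is integrable. [folklore] -/
theorem integrable_indicator_D₁ : Integrable (D₁.indicator (1 : ℂ → ℝ)) :=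
  (integrable_indicator_iff measurableSet_D₁).2 (integrableOn_const measure_ball_lt_top.ne)

/-- `1_{D₂}` is integrable. [folklore] -/
theorem integrable_indicator_D₂ : Integrable (D₂.indicator (1 : ℂ → ℝ)) :=
  (integrable_indicator_iff measurableSet_D₂).2 (integrableOn_const measure_ball_lt_top.ne)

/-- `|D₁| = |B(0,1/2)|`. [folklore] -/
theorem volume_real_D₁ : volume.real D₁ = volume.real (ball (0 : ℂ) (1 / 2)) :=
  Measure.addHaar_real_ball_center volume _ _

/-- `|D₂| = |B(0,1/2)|`. [folklore] -/
theorem volume_real_D₂ : volume.real D₂ = volume.real (ball (0 : ℂ) (1 / 2)) :=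
  Measure.addHaar_real_ball_center volume _ _

/-- Discs have positive area. [folklore] -/
theorem volume_real_pos : 0 < volume.real (ball (0 : ℂ) (1 / 2)) := by
  rw [measureReal_def]
  exact ENNReal.toReal_pos (measure_ball_pos volume 0 (by norm_num)).ne' measure_ball_lt_top.ne

/-- Neutrality of the test density. [folklore] -/
theorem integral_ftest : ∫ z, ftest z = 0 := by
  unfold ftest
  rw [integral_sub integrable_indicator_D₁ integrable_indicator_D₂, integral_indicator_one measurableSet_D₁,
    integral_indicator_one measurableSet_D₂, volume_real_D₁, volume_real_D₂, sub_self]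

/-- The inner integrand is integrable for every `x`. [folklore] -/
theorem integrable_inner (x : ℂ) : Integrable fun y ↦ Real.log ‖x - y‖ * ftest y := by
  have h := (integrableOn_log_norm_sub_ball x (‖x‖ + 6)).mul_bdd (c := 1)
    measurable_ftest.aestronglyMeasurable (ae_of_all _ fun y ↦ by rw [Real.norm_eq_abs]; exact abs_ftest_le y)
  refine IntegrableOn.integrable_of_forall_notMem_eq_zero h fun y hy ↦ ?_
  have hy5 : 5 ≤ ‖y‖ := by
    by_contra h5
    rw [not_le] at h5
    apply hy
    rw [mem_ball, dist_eq_norm]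
    calc ‖y - x‖ ≤ ‖y‖ + ‖x‖ := norm_sub_le _ _
      _ < 5 + ‖x‖ := by linarith
      _ < ‖x‖ + 6 := by linarith
  rw [ftest_eq_zero_of_norm hy5, mul_zero]

/-- The inner integral `J(x) = ∫ log‖x−y‖ f(y) dy`. [folklore] -/
def J (x : ℂ) : ℝ := ∫ y, Real.log ‖x - y‖ * ftest y

/-- For `x ∈ D₁`: `J(x) ≤ −(log 7)·|D₂|`. [folklore] -/
theorem J_le_of_mem_D₁ {x : ℂ} (hx : x ∈ D₁) : J x ≤ -(Real.log 7 * volume.real (ball (0 : ℂ) (1 / 2))) := by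
  have hle : ∀ y, Real.log ‖x - y‖ * ftest y ≤ -Real.log 7 * D₂.indicator 1 y := by
    intro y
    by_cases h1 : y ∈ D₁
    · have h2 : y ∉ D₂ := disjoint_left.1 disjoint_D h1
      rw [ftest_of_mem_D₁ h1, indicator_of_notMem h2, mul_one, mul_zero]
      exact Real.log_nonpos (norm_nonneg _) (norm_sub_lt_of_mem hx h1).le
    by_cases h2 : y ∈ D₂
    · rw [ftest_of_mem_D₂ h2, indicator_of_mem h2, Pi.one_apply, mul_one, mul_neg_one, neg_le_neg_iff]
      exact Real.log_le_log (by norm_num) (seven_le_norm_sub hx h2)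
    · rw [ftest_of_notMem h1 h2, indicator_of_notMem h2, mul_zero, mul_zero]
  have key := integral_mono (integrable_inner x) (integrable_indicator_D₂.const_mul (-Real.log 7)) hle
  rw [integral_const_mul, integral_indicator_one measurableSet_D₂, volume_real_D₂] at key
  rw [J]
  linarith

/-- For `x ∈ D₂`: `0 ≤ J(x)`. [folklore] -/
theorem J_nonneg_of_mem_D₂ {x : ℂ} (hx : x ∈ D₂) : 0 ≤ J x := by
  refine integral_nonneg fun y ↦ ?_
  simp only [Pi.zero_apply]
  by_cases h1 : y ∈ D₁
  · rw [ftest_of_mem_D₁ h1, mul_one]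
    exact Real.log_nonneg (by linarith [seven_le_norm_sub' hx h1])
  by_cases h2 : y ∈ D₂
  · rw [ftest_of_mem_D₂ h2, mul_neg_one, neg_nonneg]
    exact Real.log_nonpos (norm_nonneg _) (norm_sub_lt_of_mem hx h2).le
  · rw [ftest_of_notMem h1 h2, mul_zero]

/-- A uniform bound for `J` on the disc of radius `5`. [folklore] -/
theorem abs_J_le {x : ℂ} (hx : ‖x‖ < 5) : |J x| ≤ ∫ v in ball (0 : ℂ) 10, |Real.log ‖v‖| := by
  rw [J, ← Real.norm_eq_abs, ← setIntegral_abs_log_norm_sub_ball x 10]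
  refine (norm_integral_le_integral_norm _).trans ?_
  rw [← integral_indicator measurableSet_ball]
  refine integral_mono (integrable_inner x).norm ?_ fun y ↦ ?_
  · exact (integrable_indicator_iff measurableSet_ball).2 (integrableOn_log_norm_sub_ball x 10).abs
  · by_cases hy : y ∈ ball x 10
    · rw [indicator_of_mem hy, norm_mul, Real.norm_eq_abs, Real.norm_eq_abs]
      have := abs_ftest_le y
      have h0 : 0 ≤ |Real.log ‖x - y‖| := abs_nonneg _
      nlinarith
    · rw [indicator_of_notMem hy]
      have hy5 : 5 ≤ ‖y‖ := by
        by_contra h5; rw [not_le] at h5; apply hy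
        rw [mem_ball, dist_eq_norm]
        calc ‖y - x‖ ≤ ‖y‖ + ‖x‖ := norm_sub_le _ _
          _ < 5 + 5 := by linarith
          _ = 10 := by norm_num
      rw [ftest_eq_zero_of_norm hy5, mul_zero, norm_zero]

/-- `J` is measurable (Fubini measurability of a parametric integral). [folklore] -/
theorem stronglyMeasurable_J : StronglyMeasurable J := by
  refine StronglyMeasurable.integral_prod_right (f := fun x y ↦ Real.log ‖x - y‖ * ftest y) ?_
  refine Measurable.stronglyMeasurable ?_
  exact (Real.measurable_log.comp (measurable_fst.sub measurable_snd).norm).mul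
    (measurable_ftest.comp measurable_snd)

/-- The outer integrand `H(x) = f(x) J(x)`: pull `f(x)` out of the inner integral. [folklore] -/
theorem inner_eq (x : ℂ) : ∫ y, Real.log ‖x - y‖ * ftest x * ftest y = ftest x * J x := by
  rw [J, ← integral_const_mul]
  refine integral_congr_ae (ae_of_all _ fun y ↦ ?_)
  ring

/-- The outer integrand `f · J` is integrable (bounded on `B(0,5)`, zero outside). [folklore] -/
theorem integrable_H : Integrable fun x ↦ ftest x * J x := by
  have hmeas : AEStronglyMeasurable (fun x ↦ ftest x * J x) volume :=
    (measurable_ftest.stronglyMeasurable.mul stronglyMeasurable_J).aestronglyMeasurable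
  haveI : IsFiniteMeasure (volume.restrict (ball (0 : ℂ) 5)) :=
    isFiniteMeasure_restrict.2 measure_ball_lt_top.ne
  have hOn : IntegrableOn (fun x ↦ ftest x * J x) (ball (0 : ℂ) 5) := by
    refine ⟨hmeas.restrict, HasFiniteIntegral.of_bounded (C := ∫ v in ball (0 : ℂ) 10, |Real.log ‖v‖|) ?_⟩
    refine (ae_restrict_iff' measurableSet_ball).2 (ae_of_all _ fun x hx ↦ ?_)
    rw [mem_ball_zero_iff] at hx
    rw [norm_mul, Real.norm_eq_abs, Real.norm_eq_abs]
    have h1 := abs_ftest_le x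
    have h2 := abs_J_le hx
    have h3 : 0 ≤ |J x| := abs_nonneg _
    nlinarith
  refine hOn.integrable_of_forall_notMem_eq_zero fun x hx ↦ ?_
  rw [mem_ball_zero_iff, not_lt] at hx
  rw [ftest_eq_zero_of_norm hx, zero_mul]

/-- **The logarithmic energy of the test density is negative.** [folklore] -/
theorem Q_neg : ∫ x, ∫ y, Real.log ‖x - y‖ * ftest x * ftest y < 0 := by
  simp_rw [inner_eq]
  set κ := Real.log 7 * volume.real (ball (0 : ℂ) (1 / 2)) with hκ
  have hκpos : 0 < κ := mul_pos (Real.log_pos (by norm_num)) volume_real_pos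
  have hle : ∀ x, ftest x * J x ≤ -κ * D₁.indicator 1 x := by
    intro x
    by_cases h1 : x ∈ D₁
    · rw [ftest_of_mem_D₁ h1, indicator_of_mem h1, Pi.one_apply, one_mul, mul_one]
      exact J_le_of_mem_D₁ h1
    by_cases h2 : x ∈ D₂
    · rw [ftest_of_mem_D₂ h2, indicator_of_notMem h1, mul_zero]
      have := J_nonneg_of_mem_D₂ h2
      linarith
    · rw [ftest_of_notMem h1 h2, indicator_of_notMem h1, zero_mul, mul_zero]
  have key := integral_mono integrable_H (integrable_indicator_D₁.const_mul (-κ)) hle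
  rw [integral_const_mul, integral_indicator_one measurableSet_D₁, volume_real_D₁] at key
  have : -κ * volume.real (ball (0 : ℂ) (1 / 2)) < 0 := by
    have := volume_real_pos; nlinarith
  linarith

end CellTest

/-! ### F8, step 4: the natural strengthening "exact at every mesh" is false -/

open CellTest

/-- **Winding numbers of lattice loops are constant on the half-mesh disc about the origin.**
[folklore] -/
theorem wind_eq_wind_zero_of_mem_tLoops {δ : ℝ} (hδ : 0 < δ) {cfg : SiteConfig (Site 2)}
    {u : UnbasedLoop ℂ} (hu : u ∈ tLoops δ cfg) {z : ℂ} (hz : z ∈ ball (0 : ℂ) (δ / 2)) :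
    u.wind z = u.wind 0 := by
  obtain ⟨v, γ, hγ, rfl⟩ := hu
  simp only [UnbasedLoop.wind_mk, BasedLoop.toCurveClass_mk, siteLoopCurve, CurveClass.wind_mk]
  set c : Curve ℂ := ⟨γ.toCurve fun F ↦ (δ : ℂ) * hexCenter F⟩ with hc
  have hloop : c.IsLoop := CurveClass.isLoop_mk.1 (isLoop_siteLoopCurve δ γ)
  have hlen : 0 < γ.length := by have := hγ.1.three_le_length; omega
  have hdisj : Disjoint (ball (0 : ℂ) (δ / 2)) c.range := by
    refine Set.disjoint_left.2 fun q hq hq' ↦ ?_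
    obtain ⟨t, ht⟩ := hq'
    have hqt : q ∈ polyTrace δ γ := by
      rw [← range_toCurve_eq_polyTrace hlen]
      exact ⟨t, ht⟩
    have key := ball_disjoint_polyTrace hγ hδ 0
    rw [triMeshPoint_zero] at key
    exact Set.disjoint_left.1 key hq hqt
  exact curve_wind_eq_of_isPreconnected hloop (convex_ball _ _).isPreconnected hdisj hz
    (mem_ball_self (by linarith))

/-- **At mesh `20`, every interface loop gives the test density weight `1`**: its winding number is
constant on `B(0,10) ⊇ supp f`, so `∫_{int} f ∈ {∫ f, 0} = {0}`. [folklore] -/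
theorem loopWeight_ftest {cfg : SiteConfig (Site 2)} {u : UnbasedLoop ℂ} (hu : u ∈ tLoops 20 cfg) :
    loopWeight ftest u = 1 := by
  have hw : ∀ z ∈ ball (0 : ℂ) 10, u.wind z = u.wind 0 := fun z hz ↦
    wind_eq_wind_zero_of_mem_tLoops (by norm_num) hu (by convert hz using 2; norm_num)
  have hD₁ : D₁ ⊆ ball (0 : ℂ) 10 := D₁_subset.trans (ball_subset_ball (by norm_num))
  have hD₂ : D₂ ⊆ ball (0 : ℂ) 10 := D₂_subset.trans (ball_subset_ball (by norm_num))
  have key : ∫ z in {z : ℂ | u.wind z ≠ 0}, ftest z = 0 := by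
    unfold ftest
    rw [integral_sub integrable_indicator_D₁.restrict integrable_indicator_D₂.restrict,
      integral_indicator_one measurableSet_D₁, integral_indicator_one measurableSet_D₂,
      measureReal_restrict_apply measurableSet_D₁, measureReal_restrict_apply measurableSet_D₂]
    by_cases h0 : u.wind 0 = 0
    · have h1 : D₁ ∩ {z : ℂ | u.wind z ≠ 0} = ∅ :=
        Set.eq_empty_of_forall_notMem fun z hz ↦ hz.2 (by rw [hw z (hD₁ hz.1), h0])
      have h2 : D₂ ∩ {z : ℂ | u.wind z ≠ 0} = ∅ :=
        Set.eq_empty_of_forall_notMem fun z hz ↦ hz.2 (by rw [hw z (hD₂ hz.1), h0])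
      rw [h1, h2, sub_self]
    · have h1 : D₁ ∩ {z : ℂ | u.wind z ≠ 0} = D₁ :=
        Set.inter_eq_left.2 fun z hz ↦ by show u.wind z ≠ 0; rw [hw z (hD₁ hz)]; exact h0
      have h2 : D₂ ∩ {z : ℂ | u.wind z ≠ 0} = D₂ :=
        Set.inter_eq_left.2 fun z hz ↦ by show u.wind z ≠ 0; rw [hw z (hD₂ hz)]; exact h0
      rw [h1, h2, volume_real_D₁, volume_real_D₂, sub_self]
  rw [loopWeight, key, zero_add, Real.cos_pi_div_three]
  norm_num

/-- `Λ^𝕋_20(f) = 1` for the test density. [folklore] -/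
theorem tNesting_ftest : tNesting ftest 20 = 1 := by
  have : ∀ cfg : SiteConfig (Site 2), (∏ᶠ u ∈ tLoops 20 cfg, loopWeight ftest u) = 1 := fun cfg ↦
    finprod_mem_of_eqOn_one fun u hu ↦ loopWeight_ftest hu
  simp [tNesting, this]

/-- The Gaussian functional of the test density is `< 1` (negative logarithmic energy). [folklore] -/
theorem tGaussian_ftest_lt_one : tGaussian ftest < 1 := by
  rw [tGaussian, Real.exp_lt_one_iff]
  have hQ := Q_neg
  have hc : 0 < 3 / (4 * Real.pi ^ 2) := by positivity
  nlinarith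

/-- The test density is admissible (with `R = 5`, `C = 1`). [folklore] -/
theorem ftest_admissible :
    Measurable ftest ∧ (∀ z, |ftest z| ≤ 1) ∧ (∀ z, (5 : ℝ) < ‖z‖ → ftest z = 0) ∧ ∫ z, ftest z = 0 :=
  ⟨measurable_ftest, abs_ftest_le, fun _ hz ↦ ftest_eq_zero_of_norm hz.le, integral_ftest⟩

/-- **F8 (natural strengthening refuted). The magic formula is not an exact lattice identity on
`𝕋`**: the strengthening "`Λ^𝕋_δ(f) = Gaussian(f)` at EVERY mesh `δ > 0` for every admissible `f`"
(the crux with `Tendsto … (𝓝[>] 0)` replaced by equality at each mesh) fails at mesh `20` for the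
neutral density `1_{B(4,1/2)} − 1_{B(−4,1/2)}`, where `Λ = 1 > Gaussian`. All content of the crux is
in the limit `δ → 0`. [folklore] -/
theorem not_magicFormulaTEveryMesh :
    ¬ (∀ δ : ℝ, 0 < δ → ∀ (f : ℂ → ℝ) (R C : ℝ), Measurable f → (∀ z, |f z| ≤ C) →
        (∀ z, R < ‖z‖ → f z = 0) → ∫ z, f z = 0 → tNesting f δ = tGaussian f) := by
  intro h
  obtain ⟨hm, hb, hs, hi⟩ := ftest_admissible
  have key := h 20 (by norm_num) ftest 5 1 hm hb hs hi
  rw [tNesting_ftest] at key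
  have := tGaussian_ftest_lt_one
  linarith

/-! ### F9: the crux is implied by the target (why it resists) -/

open Theses.CardyMagicRigidity in
/-- **F9 (why it resists: the crux is implied by the target).** `LoopLimitZ2EqT` (rank 0) together
with the input fact `MagicFormulaZ2` (rank 2, DKLM Cor 10) and the support `TransferContinuity`
(rank 9) gives `MagicFormulaT`: `Λ^𝕋 = Λ^{ℤ²} − (Λ^{ℤ²} − Λ^𝕋) → G(f) − 0`. Hence any refutation of
the crux refutes `X ∧ Cor10 ∧ Transfer`, i.e. (granting the 2026 theorem and the routine transfer)
full-plane loop universality `ℤ² ~ 𝕋` itself. [folklore] -/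
theorem magicFormulaT_of_loopLimit (hX : LoopLimitZ2EqT) (h2 : MagicFormulaZ2)
    (h9 : TransferContinuity) : MagicFormulaT := by
  intro f R C hf hC hR h0
  have hZ := h2 f R C hf hC hR h0
  have hD := h9 hX f R C hf hC hR h0
  have key := hZ.sub hD
  simp only [sub_zero] at key
  refine key.congr' (Eventually.of_forall fun δ ↦ ?_)
  simp only [sub_sub_cancel]

end Summit.CriticalPhenomena.CardyFormulaZ2.Cruxes.MagicFormulaT.Disproof

end
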